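import Literature.NumberTheory.Weil1964.AdelicMetaplecticTransport
import Literature.NumberTheory.Weil1964.AdelicDoublingDiagonalLift
import Literature.NumberTheory.Weil1964.AdelicMetaplecticSeesawConjugate
import Literature.NumberTheory.GelbartRogawski1991.DoubledWeilRepresentationRationalParabolic
import Literature.NumberTheory.GelbartRogawski1991.DoubledWeilRepresentationUndoubling
import HarnessLib

/-!
# Transport of the `δ`-evaluation scalars of the doubled Weil representation under a relabelled conjugation

[GelbartRogawski1991, §3.1 Prop. 3.1.1 p. 455 L1–2] pins the Weil representation `ω^𝔻_χ` of the doubled unitary group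
`H = U(𝕍 ⊕ −𝕍)` by its value-at-the-origin scalars on the Siegel parabolic `P_Δ(𝔸)` after conjugation by Weil's lift
`r_Δ = r_F^𝔻(δ)` of the standard rational matrix `δ` ([Weil1964, Chap. III n° 41 Thm 6 p. 193]).  When `ω^𝔻[dV]_χ` is transported
to a second hermitian frame `dV′` along `X ↦ relabel_{C⁻¹}(r⁻¹ X r)` (`conjRelabel r C hC`, `T^𝔻[dV]·C = T^𝔻[dV′]`,
[MoeglinVignerasWaldspurger1987, Chap. 2 II.1 (A)–(B)]; [Kudla1994, §2, Thm. 3.1]), those scalars are preserved as soon as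
`u := r_Δ r⁻¹ r_Δ⁻¹` and `u⁻¹` fix the value at the origin:
* §1 (generic, namespace `Literature.NumberTheory.Weil1964`): for ANY relabelling `Λ_C`, `T·C = T′`, the rational symplectic
  matrices do not move (`symplecticGroupCongr_relabelVec_ratSp'`) and `relabel_C (r_{T′} γ) = r_T γ` by `Θ`-rigidity
  (`adelicMpContRelabel_ratThetaLiftCont`) — the general-`C` twin of `AdelicMetaplecticRationalLiftRelabel` (`C = −1`);
* §2 `relabel_rDelta_of_relabel`: `Rel (r_Δ[dV]) = r_Δ[dV′]` (same standard matrix `deltaD` in both frames);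
* §3 `hpar_of_delta_fixing`: the transport of the `δ`-evaluation scalars from the `δ₀`-fixing of `u^{±1}`;
* §4 the `δ₀`-fixing for `r = r_F^𝔻(B)`, `B` a rational symplectic matrix with `B^{±1}` preserving the Darboux-diagonal vectors
  `P(a,a;z,z)`: `δ B^{∓1} δ⁻¹ ∈ ⟨m(a), v(σ)⟩` (`deltaD_conj_mem_closure_of_mulVec_diag`, the pattern of
  `S3dec_siegel_decomposition`) and S3b-val `rFD_mem_evalZeroFixing_of_mem_closure`
  (`opD_rDelta_conj_rFD_inv_apply_zero`, `opD_rDelta_conj_rFD_inv_inv_apply_zero`); plus the bookkeeping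
  `reindexGL_blockDiagGL_mulVec_diag` (`reindex_{e₂}(k ⊕ k)` preserves diagonal vectors).
-/

set_option autoImplicit false

noncomputable section

namespace Literature.NumberTheory.Weil1964

open Matrix NumberField IsDedekindDomain
open Literature.RepresentationTheory.HeisenbergGroup Literature.RepresentationTheory.HeisenbergGroup.SymplecticMatrix
open Literature.NumberTheory.Automorphic
open Literature.NumberTheory.Automorphic.UnitaryGroup (symplecticGroupCongr coe_symplecticGroupCongr_apply)

/-! ## §1 Any relabel `Λ_C` fixes the rational symplectic matrices and Weil's rational lift -/

section Relabel

variable (F : Type) [Field F] [NumberField F] {n : ℕ} (T : Matrix (Fin n) (Fin n) (AdeleRing (𝓞 F) F)) (hT : IsUnit T.det)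
  {T' : Matrix (Fin n) (Fin n) (AdeleRing (𝓞 F) F)} (C : GL (Fin n) (AdeleRing (𝓞 F) F))
  (hC : T * (C : Matrix (Fin n) (Fin n) (AdeleRing (𝓞 F) F)) = T') (hT' : IsUnit T'.det)

/-- **the rational symplectic matrix does not move under ANY relabelling** `Λ_C = (x, y) ↦ (x, C y)`, `T C = T′`:
`Λ_C (ratSp T′ γ) Λ_C⁻¹ = ratSp T γ` — both are `(x, y) ↦ (a x + b T y, T⁻¹(c x + d T y))` (`(TC)⁻¹ = C⁻¹T⁻¹`).
[cite: Weil1964, Chap. V n° 46 p. 202] [cite: MoeglinVignerasWaldspurger1987, Chap. 2 II.1 (A)] -/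
theorem symplecticGroupCongr_relabelVec_ratSp' (γ : Matrix.symplecticGroup (Fin n) F) :
    symplecticGroupCongr (polar (adelicForm F (Fin n) T')) (polar (adelicForm F (Fin n) T)) (relabelVec F (Fin n) C)
        (polar_relabelVec F (Fin n) C hC) (ratSp F T' hT' γ) = ratSp F T hT γ := by
  subst hC
  have hCinv : (T * (C : Matrix (Fin n) (Fin n) (AdeleRing (𝓞 F) F)))⁻¹ =
      ((C⁻¹ : GL (Fin n) (AdeleRing (𝓞 F) F)) : Matrix (Fin n) (Fin n) (AdeleRing (𝓞 F) F)) * T⁻¹ :=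
    Matrix.inv_eq_left_inv (by rw [Matrix.mul_assoc, Matrix.nonsing_inv_mul_cancel_left T _ hT, Units.inv_mul])
  have e1 : ∀ z : Fin n → AdeleRing (𝓞 F) F, (T * (C : Matrix (Fin n) (Fin n) (AdeleRing (𝓞 F) F))) *ᵥ
      (((C⁻¹ : GL (Fin n) (AdeleRing (𝓞 F) F)) : Matrix (Fin n) (Fin n) (AdeleRing (𝓞 F) F)) *ᵥ z) = T *ᵥ z := fun z => by
    rw [Matrix.mulVec_mulVec, Matrix.mul_assoc, Units.mul_inv, Matrix.mul_one]
  have e2 : ∀ z : Fin n → AdeleRing (𝓞 F) F, (C : Matrix (Fin n) (Fin n) (AdeleRing (𝓞 F) F)) *ᵥ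
      ((((C⁻¹ : GL (Fin n) (AdeleRing (𝓞 F) F)) : Matrix (Fin n) (Fin n) (AdeleRing (𝓞 F) F)) * T⁻¹) *ᵥ z) = T⁻¹ *ᵥ z :=
    fun z => by rw [Matrix.mulVec_mulVec, ← Matrix.mul_assoc, Units.mul_inv, Matrix.one_mul]
  refine Subtype.ext (LinearEquiv.ext fun v => ?_)
  obtain ⟨x', y'⟩ := v
  rw [coe_symplecticGroupCongr_apply, relabelVec_symm_apply, relabelVec_apply]
  dsimp only
  rw [ratSp, ratSp, MonoidHom.comp_apply, MonoidHom.comp_apply, coe_transportSp_apply_blocks, coe_transportSp_apply_blocks,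
    hCinv, e1, e2]

/-- **`relabel_C (r_{T′}(γ)) = r_T(γ)` in `Mp_ψ(W_T)`** for Weil's Θ-rigid rational lift and ANY relabel `C` with `T C = T′`: the relabelled pair
has the same operator (fixes `Θ`) and lies over `Λ_C (ratSp T′ γ) Λ_C⁻¹ = ratSp T γ`; Θ-rigidity ★ `adelicMpRelabel_eq_of_proj_eq`.
[cite: Weil1964, Chap. III n° 40 p. 190, n° 41 Thm 6 p. 193] [cite: MoeglinVignerasWaldspurger1987, Chap. 2 II.1] -/
theorem adelicMpRelabel_ratThetaLiftCont (γ : Matrix.symplecticGroup (Fin n) F) :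
    adelicMpRelabel F (Fin n) C hC (ratThetaLiftCont F T' hT' γ : adelicMp F (Fin n) T') =
      (ratThetaLiftCont F T hT γ : adelicMp F (Fin n) T) :=
  adelicMpRelabel_eq_of_proj_eq F (Fin n) C hC (mulVec_surjective_of_isUnit_det F T hT)
    (coe_ratThetaLiftCont_mem_adelicMpTheta F T' hT' γ) (coe_ratThetaLiftCont_mem_adelicMpTheta F T hT γ)
    ((proj_coe_ratThetaLiftCont F T hT γ).trans
      ((symplecticGroupCongr_relabelVec_ratSp' F T hT C hC hT' γ).symm.trans
        (congrArg _ (proj_coe_ratThetaLiftCont F T' hT' γ).symm)))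

/-- **`relabel_C (r_{T′}(γ)) = r_T(γ)` on the group of record** `Mp_ψ(W_𝔸)ᶜᵒⁿᵗ`. [cite: Weil1964, Chap. III n° 40 p. 190, n° 41 Thm 6 p. 193] -/
theorem adelicMpContRelabel_ratThetaLiftCont (γ : Matrix.symplecticGroup (Fin n) F) :
    adelicMpContRelabel F (Fin n) C hC (ratThetaLiftCont F T' hT' γ) = ratThetaLiftCont F T hT γ :=
  Subtype.ext (adelicMpRelabel_ratThetaLiftCont F T hT C hC hT' γ)

/-- the inverse direction: `relabel_C⁻¹ (r_T(γ)) = r_{T′}(γ)`. [cite: Weil1964, Chap. III n° 40 p. 190, n° 41 Thm 6 p. 193] -/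
theorem adelicMpContRelabel_symm_ratThetaLiftCont (γ : Matrix.symplecticGroup (Fin n) F) :
    (adelicMpContRelabel F (Fin n) C hC).symm (ratThetaLiftCont F T hT γ) = ratThetaLiftCont F T' hT' γ :=
  (MulEquiv.symm_apply_eq _).2 (adelicMpContRelabel_ratThetaLiftCont F T hT C hC hT' γ).symm

end Relabel

end Literature.NumberTheory.Weil1964

/-! ## §2–§3 At the doubled data: `Rel r_Δ = r′_Δ` and the transport of the `δ`-evaluation scalars -/

namespace Literature.NumberTheory.GelbartRogawski1991.GRConstruction

open Matrix NumberField IsDedekindDomain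
open Literature.RepresentationTheory.HeisenbergGroup Literature.RepresentationTheory.HeisenbergGroup.SymplecticMatrix
  Literature.NumberTheory.Weil1964
open Literature.NumberTheory.Automorphic
open Literature.NumberTheory.Automorphic.UnitaryGroup
open UnitaryDualPair

variable (L : Type) [Field L] [NumberField L] [IsCMField L]
  {N M n : ℕ} (e : Fin N × Fin M ≃ Fin n)
  (dV : Fin N → L) (hdV : ∀ i, IsCMField.complexConj L (dV i) = dV i) (hdV0 : ∀ i, dV i ≠ 0)
  (dV' : Fin N → L) (hdV' : ∀ i, IsCMField.complexConj L (dV' i) = dV' i) (hdV'0 : ∀ i, dV' i ≠ 0)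
  (dW : Fin M → L) (hdW : ∀ i, IsCMField.complexConj L (dW i) = dW i) (hdW0 : ∀ i, dW i ≠ 0)

/-- abstract group bookkeeping: `a (r⁻¹ x r) a⁻¹ = u (a x a⁻¹) u⁻¹` with `u := a r⁻¹ a⁻¹`. [folklore] -/
private theorem conj_conj_eq {G : Type*} [Group G] (a r x : G) :
    a * (r⁻¹ * x * r) * a⁻¹ = (a * r⁻¹ * a⁻¹) * (a * x * a⁻¹) * (a * r⁻¹ * a⁻¹)⁻¹ := by
  group

/-- abstract: `f d · (f g)⁻¹ · (f d)⁻¹ = (f (d g d⁻¹))⁻¹` for a group homomorphism. [folklore] -/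
private theorem map_conj_inv_eq {G H : Type*} [Group G] [Group H] (f : G →* H) (d g : G) :
    f d * (f g)⁻¹ * (f d)⁻¹ = (f (d * g * d⁻¹))⁻¹ := by
  rw [map_mul, map_mul, map_inv, _root_.mul_inv_rev, _root_.mul_inv_rev, inv_inv, mul_assoc]

/-- abstract: `(f d · (f g)⁻¹ · (f d)⁻¹)⁻¹ = f (d g d⁻¹)`. [folklore] -/
private theorem map_conj_inv_eq' {G H : Type*} [Group G] [Group H] (f : G →* H) (d g : G) :
    (f d * (f g)⁻¹ * (f d)⁻¹)⁻¹ = f (d * g * d⁻¹) := by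
  rw [map_conj_inv_eq, inv_inv]

/-- abstract: `r′ · R x · r′⁻¹ = R (r · x · r⁻¹)` when `R r = r′` (no large type is unfolded). [folklore] -/
private theorem conj_eq_map_conj {G H : Type*} [Group G] [Group H] (R : G ≃* H) (r : G) {r' : H} (hr : R r = r') (x : G) :
    r' * R x * r'⁻¹ = R (r * x * r⁻¹) := by
  subst hr
  rw [map_mul, map_mul, map_inv]

section Doubled

variable {L e dV hdV hdV0 dV' hdV' hdV'0 dW hdW hdW0}

include hdV0 hdV'0 hdW0 in
set_option maxHeartbeats 400000 in
-- (two `MpD` telescopes)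
/-- **`Rel (r_Δ[dV]) = r_Δ[dV′]`** for the relabelling `Rel := relabel_{C⁻¹} : Mp(𝕎^𝔻[dV])ᶜᵒⁿᵗ ≃* Mp(𝕎^𝔻[dV′])ᶜᵒⁿᵗ` of ANY `C` with
`T^𝔻[dV]·C = T^𝔻[dV′]` — Weil's `δ = deltaD` is the SAME standard rational matrix for both frames (§1).
[cite: Weil1964, Chap. III n° 40 p. 190, n° 41 Thm 6 p. 193] [cite: Kudla1994, §2 (doubled space, Siegel parabolic)] -/
theorem relabel_rDelta_of_relabel (C : GL (Fin (n + n)) (AdeleRing (𝓞 (Fp L)) (Fp L)))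
    (hC : gramDA L e dV hdV dW hdW * (C : Matrix (Fin (n + n)) (Fin (n + n)) (AdeleRing (𝓞 (Fp L)) (Fp L))) = gramDA L e dV' hdV' dW hdW) :
    adelicMpContRelabel (Fp L) (Fin (n + n)) C⁻¹ (mul_inv_eq_of_relabel (Fp L) (Fin (n + n)) C hC)
        (rDelta L e dV hdV hdV0 dW hdW hdW0) = rDelta L e dV' hdV' hdV'0 dW hdW hdW0 :=
  adelicMpContRelabel_ratThetaLiftCont (Fp L) (gramDA L e dV' hdV' dW hdW) (isUnit_det_gramDA L e dV' hdV' hdV'0 dW hdW hdW0) C⁻¹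
    (mul_inv_eq_of_relabel (Fp L) (Fin (n + n)) C hC) (isUnit_det_gramDA L e dV hdV hdV0 dW hdW hdW0) (deltaD L)

include hdV0 hdV'0 hdW0 in
set_option maxHeartbeats 800000 in
-- (the two `MpD` telescopes; `opD` through the relabelling)
/-- **the transport of the `δ`-evaluation scalars FROM THE `δ₀`-FIXING OF `u := r_Δ r⁻¹ r_Δ⁻¹` AND `u⁻¹`.**
For ANY conjugator `r` and relabel `C` (`T^𝔻[dV]·C = T^𝔻[dV′]`):
if `ω(u)` and `ω(u⁻¹)` fix `δ₀` (`hu0`, `hu0'`), then `conjRelabel r C hC` TRANSPORTS `δ`-EVALUATION SCALARS, because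
`r′_Δ · conjRelabel r C hC X · r′_Δ⁻¹ = Rel (u (r_Δ X r_Δ⁻¹) u⁻¹)` (`Rel r_Δ = r′_Δ`, §2) and `Rel` does not move operators (★ `omega_relabel`).
For `r = r_F^𝔻(B)` with `B^{±1}` preserving Darboux-diagonal vectors, `hu0/hu0'` are §4 below.
[cite: Weil1964, Chap. I n° 13 p. 160; Chap. III n° 41 Thm 6 p. 193] [cite: Kudla1994, §2 (doubled space, Siegel parabolic), Thm. 3.1]
[cite: HarrisKudlaSweet1996, §1 (1.14)–(1.15)] -/
theorem hpar_of_delta_fixing (C : GL (Fin (n + n)) (AdeleRing (𝓞 (Fp L)) (Fp L)))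
    (hC : gramDA L e dV hdV dW hdW * (C : Matrix (Fin (n + n)) (Fin (n + n)) (AdeleRing (𝓞 (Fp L)) (Fp L))) = gramDA L e dV' hdV' dW hdW)
    (r : MpD L e dV hdV dW hdW)
    (hu0 : ∀ Ψ : piSchwartzBruhat (Fp L) (Fin (n + n)), opD L e dV hdV dW hdW
      (rDelta L e dV hdV hdV0 dW hdW hdW0 * r⁻¹ * (rDelta L e dV hdV hdV0 dW hdW hdW0)⁻¹) Ψ 0 = (Ψ : (Fin (n + n) → AdeleRing (𝓞 (Fp L)) (Fp L)) → ℂ) 0)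
    (hu0' : ∀ Ψ : piSchwartzBruhat (Fp L) (Fin (n + n)), opD L e dV hdV dW hdW
      (rDelta L e dV hdV hdV0 dW hdW hdW0 * r⁻¹ * (rDelta L e dV hdV hdV0 dW hdW hdW0)⁻¹)⁻¹ Ψ 0 = (Ψ : (Fin (n + n) → AdeleRing (𝓞 (Fp L)) (Fp L)) → ℂ) 0)
    (X : MpD L e dV hdV dW hdW) (c : ℂ)
    (hX : ∀ Ψ : piSchwartzBruhat (Fp L) (Fin (n + n)),
      opD L e dV hdV dW hdW (rDelta L e dV hdV hdV0 dW hdW hdW0 * X * (rDelta L e dV hdV hdV0 dW hdW hdW0)⁻¹) Ψ 0 =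
        c * (Ψ : (Fin (n + n) → AdeleRing (𝓞 (Fp L)) (Fp L)) → ℂ) 0)
    (Φ : piSchwartzBruhat (Fp L) (Fin (n + n))) :
    opD L e dV' hdV' dW hdW (rDelta L e dV' hdV' hdV'0 dW hdW hdW0 * conjRelabel (Fp L) (Fin (n + n)) r C hC X *
      (rDelta L e dV' hdV' hdV'0 dW hdW hdW0)⁻¹) Φ 0 = c * (Φ : (Fin (n + n) → AdeleRing (𝓞 (Fp L)) (Fp L)) → ℂ) 0 := by
  -- value at 0 after conjugating by `u`
  have key : opD L e dV hdV dW hdW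
      ((rDelta L e dV hdV hdV0 dW hdW hdW0 * r⁻¹ * (rDelta L e dV hdV hdV0 dW hdW hdW0)⁻¹) *
        (rDelta L e dV hdV hdV0 dW hdW hdW0 * X * (rDelta L e dV hdV hdV0 dW hdW hdW0)⁻¹) *
        (rDelta L e dV hdV hdV0 dW hdW hdW0 * r⁻¹ * (rDelta L e dV hdV hdV0 dW hdW hdW0)⁻¹)⁻¹) Φ 0 =
      c * (Φ : (Fin (n + n) → AdeleRing (𝓞 (Fp L)) (Fp L)) → ℂ) 0 := by
    rw [opD_mul, opD_mul, hu0]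
    exact (hX _).trans (congrArg (c * ·) (hu0' Φ))
  -- bookkeeping through the relabelling
  have e0 := conjRelabel_apply (Fp L) (Fin (n + n)) r C hC X
  have e2 : rDelta L e dV' hdV' hdV'0 dW hdW hdW0 *
        adelicMpContRelabel (Fp L) (Fin (n + n)) C⁻¹ (mul_inv_eq_of_relabel (Fp L) (Fin (n + n)) C hC) (r⁻¹ * X * r) *
        (rDelta L e dV' hdV' hdV'0 dW hdW hdW0)⁻¹ =
      adelicMpContRelabel (Fp L) (Fin (n + n)) C⁻¹ (mul_inv_eq_of_relabel (Fp L) (Fin (n + n)) C hC)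
        ((rDelta L e dV hdV hdV0 dW hdW hdW0 * r⁻¹ * (rDelta L e dV hdV hdV0 dW hdW hdW0)⁻¹) *
          (rDelta L e dV hdV hdV0 dW hdW hdW0 * X * (rDelta L e dV hdV hdV0 dW hdW hdW0)⁻¹) *
          (rDelta L e dV hdV hdV0 dW hdW hdW0 * r⁻¹ * (rDelta L e dV hdV hdV0 dW hdW hdW0)⁻¹)⁻¹) := by
    exact (conj_eq_map_conj (adelicMpContRelabel (Fp L) (Fin (n + n)) C⁻¹ (mul_inv_eq_of_relabel (Fp L) (Fin (n + n)) C hC))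
        (rDelta L e dV hdV hdV0 dW hdW hdW0) (relabel_rDelta_of_relabel (hdV0 := hdV0) (hdV'0 := hdV'0) (hdW0 := hdW0) C hC)
        (r⁻¹ * X * r)).trans
      (congrArg (adelicMpContRelabel (Fp L) (Fin (n + n)) C⁻¹ (mul_inv_eq_of_relabel (Fp L) (Fin (n + n)) C hC))
        (conj_conj_eq (rDelta L e dV hdV hdV0 dW hdW hdW0) r X))
  have e3 : ∀ m : MpD L e dV hdV dW hdW,
      opD L e dV' hdV' dW hdW (adelicMpContRelabel (Fp L) (Fin (n + n)) C⁻¹ (mul_inv_eq_of_relabel (Fp L) (Fin (n + n)) C hC) m) Φ =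
        opD L e dV hdV dW hdW m Φ := fun m =>
    congrArg (fun T : Module.End ℂ (piSchwartzBruhat (Fp L) (Fin (n + n))) =>
      ((T Φ : piSchwartzBruhat (Fp L) (Fin (n + n))) : (Fin (n + n) → AdeleRing (𝓞 (Fp L)) (Fp L)) → ℂ))
      (adelicMpCont.omega_relabel (Fp L) (Fin (n + n)) C⁻¹ (mul_inv_eq_of_relabel (Fp L) (Fin (n + n)) C hC) m)
  exact (congrArg (fun y => opD L e dV' hdV' dW hdW
      (rDelta L e dV' hdV' hdV'0 dW hdW hdW0 * y * (rDelta L e dV' hdV' hdV'0 dW hdW hdW0)⁻¹) Φ 0) e0).trans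
    ((congrArg (fun m => opD L e dV' hdV' dW hdW m Φ 0) e2).trans
      ((congr_fun (e3 ((rDelta L e dV hdV hdV0 dW hdW hdW0 * r⁻¹ * (rDelta L e dV hdV hdV0 dW hdW hdW0)⁻¹) *
        (rDelta L e dV hdV hdV0 dW hdW hdW0 * X * (rDelta L e dV hdV hdV0 dW hdW hdW0)⁻¹) *
        (rDelta L e dV hdV hdV0 dW hdW hdW0 * r⁻¹ * (rDelta L e dV hdV hdV0 dW hdW hdW0)⁻¹)⁻¹)) 0).trans key))

end Doubled

/-! ## §4 The `δ₀`-fixing of `u^{±1}` for `r = r_F^𝔻(B)`, `B^{±1}` preserving the Darboux-diagonal vectors -/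

section DeltaFixing

/-- `reindex_{e₂}(k ⊕ k) · (W, W) = (kW, kW)`: the doubled block-diagonal matrices preserve the diagonal `Δ` of `𝕍 ⊕ 𝕍`.
[cite: Kudla1994, §2 (doubled space, Siegel parabolic), Thm. 3.1] -/
theorem reindexGL_blockDiagGL_mulVec_diag {S : Type*} [CommRing S] (k : GL (Fin n) S) (W : Fin n → S) :
    ((reindexGL (e₂ (n := n)) (blockDiagGL (k, k)) : GL (Fin (n + n)) S) : Matrix (Fin (n + n)) (Fin (n + n)) S) *ᵥ
        (Sum.elim W W ∘ ⇑(e₂ (n := n)).symm) =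
      Sum.elim ((k : Matrix (Fin n) (Fin n) S) *ᵥ W) ((k : Matrix (Fin n) (Fin n) S) *ᵥ W) ∘ ⇑(e₂ (n := n)).symm := by
  have h1 : Matrix.reindex (e₂ (n := n)).symm (e₂ (n := n)).symm
      ((reindexGL (e₂ (n := n)) (blockDiagGL (k, k)) : GL (Fin (n + n)) S) : Matrix (Fin (n + n)) (Fin (n + n)) S) =
      Matrix.fromBlocks (k : Matrix (Fin n) (Fin n) S) 0 0 (k : Matrix (Fin n) (Fin n) S) := by
    rw [coe_reindexGL, coe_blockDiagGL]
    exact (Matrix.reindex (e₂ (n := n)) (e₂ (n := n))).symm_apply_apply _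
  rw [mulVec_comp_equiv_symm', h1, Matrix.fromBlocks_mulVec, Sum.elim_comp_inl, Sum.elim_comp_inr, Matrix.zero_mulVec,
    add_zero, zero_add]


include hdV0 hdW0 in
/-- **`δ B δ⁻¹ ∈ ⟨m(a), v(σ)⟩`** for every rational symplectic `B` mapping Darboux-diagonal vectors to Darboux-diagonal vectors: it
preserves `𝕐 = δ(PΔ)` (★ `exists_deltaD_mulVec_eq`, ★ `deltaD_mulVec_diag`), so its upper-right block vanishes
(★ `toBlocks₁₂_eq_zero_of_mulVec`, ★ `mem_closure_levi_low_of_toBlocks₁₂_eq_zero`) — the pattern of ★ `S3dec_siegel_decomposition`.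
[cite: GelbartRogawski1991, §3.1 Prop. 3.1.1 p. 455 L1–2] -/
theorem deltaD_conj_mem_closure_of_mulVec_diag (B : Matrix.symplecticGroup (Fin (n + n)) (Fp L))
    (hB : ∀ a z : Fin n → Fp L, ∃ a' z' : Fin n → Fp L,
      (B : Matrix (Fin (n + n) ⊕ Fin (n + n)) (Fin (n + n) ⊕ Fin (n + n)) (Fp L)) *ᵥ
          Sum.elim (Sum.elim a a ∘ ⇑(e₂ (n := n)).symm) (gramD L e dV hdV dW hdW *ᵥ (Sum.elim z z ∘ ⇑(e₂ (n := n)).symm)) =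
        Sum.elim (Sum.elim a' a' ∘ ⇑(e₂ (n := n)).symm) (gramD L e dV hdV dW hdW *ᵥ (Sum.elim z' z' ∘ ⇑(e₂ (n := n)).symm))) :
    deltaD L * B * (deltaD L)⁻¹ ∈ Submonoid.closure ((Set.range (SymplecticMatrix.levi (l := Fin (n + n)) (R := Fp L))) ∪
      {x | ∃ σ hσ, x = SymplecticMatrix.low (l := Fin (n + n)) (R := Fp L) σ hσ}) := by
  apply mem_closure_levi_low_of_toBlocks₁₂_eq_zero
  apply toBlocks₁₂_eq_zero_of_mulVec
  intro y
  obtain ⟨a, z, hy⟩ := exists_deltaD_mulVec_eq L e dV hdV hdV0 dW hdW hdW0 y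
  obtain ⟨a', z', hB'⟩ := hB a z
  refine ⟨Sum.elim (gramR L e dV hdV dW hdW *ᵥ z') (-a') ∘ ⇑(e₂ (n := n)).symm, ?_⟩
  have hinv : (((deltaD L)⁻¹ : Matrix.symplecticGroup (Fin (n + n)) (Fp L)) :
      Matrix (Fin (n + n) ⊕ Fin (n + n)) (Fin (n + n) ⊕ Fin (n + n)) (Fp L)) *
      ((deltaD L : Matrix.symplecticGroup (Fin (n + n)) (Fp L)) : Matrix _ _ (Fp L)) = 1 := by
    rw [← Submonoid.coe_mul, inv_mul_cancel]; rfl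
  have hδu : (((deltaD L)⁻¹ : Matrix.symplecticGroup (Fin (n + n)) (Fp L)) :
      Matrix (Fin (n + n) ⊕ Fin (n + n)) (Fin (n + n) ⊕ Fin (n + n)) (Fp L)) *ᵥ
      (((deltaD L : Matrix.symplecticGroup (Fin (n + n)) (Fp L)) : Matrix _ _ (Fp L)) *ᵥ
        Sum.elim (Sum.elim a a ∘ ⇑(e₂ (n := n)).symm)
          (gramD L e dV hdV dW hdW *ᵥ (Sum.elim z z ∘ ⇑(e₂ (n := n)).symm))) =
      Sum.elim (Sum.elim a a ∘ ⇑(e₂ (n := n)).symm)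
        (gramD L e dV hdV dW hdW *ᵥ (Sum.elim z z ∘ ⇑(e₂ (n := n)).symm)) := by
    rw [Matrix.mulVec_mulVec, hinv, Matrix.one_mulVec]
  rw [Submonoid.coe_mul, Submonoid.coe_mul, ← Matrix.mulVec_mulVec, ← Matrix.mulVec_mulVec, ← hy, hδu, hB',
    deltaD_mulVec_diag]

/-- abstract: `f d · (f g)⁻¹ · (f d)⁻¹ = f (d g⁻¹ d⁻¹)` for a group homomorphism. [folklore] -/
private theorem map_conj_inv {G H : Type*} [Group G] [Group H] (f : G →* H) (d g : G) :
    f d * (f g)⁻¹ * (f d)⁻¹ = f (d * g⁻¹ * d⁻¹) := by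
  rw [map_mul, map_mul, map_inv, map_inv]

include hdV0 hdW0 in
set_option maxHeartbeats 1000000 in
-- (one `MpD` telescope)
/-- **`ω(r_Δ · r_F^𝔻(B)⁻¹ · r_Δ⁻¹) Ψ (0) = Ψ(0)`** when `B⁻¹` preserves Darboux-diagonal vectors: the element is `r_F^𝔻(δ B⁻¹ δ⁻¹)`,
a word in rational Levi ∕ lower-unipotent generators, whose operators fix the value at the origin (S3b-val,
★ `rFD_mem_evalZeroFixing_of_mem_closure`). [cite: GelbartRogawski1991, §3.1 Prop. 3.1.1 p. 455 L1–2] [cite: Weil1964, Chap. I n° 13 p. 160] -/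
theorem opD_rDelta_conj_rFD_inv_apply_zero (B : Matrix.symplecticGroup (Fin (n + n)) (Fp L))
    (hB' : ∀ a z : Fin n → Fp L, ∃ a' z' : Fin n → Fp L,
      ((B⁻¹ : Matrix.symplecticGroup (Fin (n + n)) (Fp L)) :
          Matrix (Fin (n + n) ⊕ Fin (n + n)) (Fin (n + n) ⊕ Fin (n + n)) (Fp L)) *ᵥ
          Sum.elim (Sum.elim a a ∘ ⇑(e₂ (n := n)).symm) (gramD L e dV hdV dW hdW *ᵥ (Sum.elim z z ∘ ⇑(e₂ (n := n)).symm)) =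
        Sum.elim (Sum.elim a' a' ∘ ⇑(e₂ (n := n)).symm) (gramD L e dV hdV dW hdW *ᵥ (Sum.elim z' z' ∘ ⇑(e₂ (n := n)).symm)))
    (Ψ : piSchwartzBruhat (Fp L) (Fin (n + n))) :
    opD L e dV hdV dW hdW (rDelta L e dV hdV hdV0 dW hdW hdW0 * (rFD L e dV hdV hdV0 dW hdW hdW0 B)⁻¹ *
        (rDelta L e dV hdV hdV0 dW hdW hdW0)⁻¹) Ψ 0 = (Ψ : (Fin (n + n) → AdeleRing (𝓞 (Fp L)) (Fp L)) → ℂ) 0 := by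
  have h := rFD_mem_evalZeroFixing_of_mem_closure L e dV hdV hdV0 dW hdW hdW0
    (deltaD_conj_mem_closure_of_mulVec_diag L e dV hdV hdV0 dW hdW hdW0 B⁻¹ hB')
  rw [← map_conj_inv (rFD L e dV hdV hdV0 dW hdW hdW0) (deltaD L) B] at h
  exact h Ψ

include hdV0 hdW0 in
set_option maxHeartbeats 1000000 in
-- (one `MpD` telescope)
/-- **`ω((r_Δ · r_F^𝔻(B)⁻¹ · r_Δ⁻¹)⁻¹) Ψ (0) = Ψ(0)`** when `B` preserves Darboux-diagonal vectors (the element is `r_F^𝔻(δ B δ⁻¹)`; S3b-val).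
[cite: GelbartRogawski1991, §3.1 Prop. 3.1.1 p. 455 L1–2] [cite: Weil1964, Chap. I n° 13 p. 160] -/
theorem opD_rDelta_conj_rFD_inv_inv_apply_zero (B : Matrix.symplecticGroup (Fin (n + n)) (Fp L))
    (hB : ∀ a z : Fin n → Fp L, ∃ a' z' : Fin n → Fp L,
      (B : Matrix (Fin (n + n) ⊕ Fin (n + n)) (Fin (n + n) ⊕ Fin (n + n)) (Fp L)) *ᵥ
          Sum.elim (Sum.elim a a ∘ ⇑(e₂ (n := n)).symm) (gramD L e dV hdV dW hdW *ᵥ (Sum.elim z z ∘ ⇑(e₂ (n := n)).symm)) =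
        Sum.elim (Sum.elim a' a' ∘ ⇑(e₂ (n := n)).symm) (gramD L e dV hdV dW hdW *ᵥ (Sum.elim z' z' ∘ ⇑(e₂ (n := n)).symm)))
    (Ψ : piSchwartzBruhat (Fp L) (Fin (n + n))) :
    opD L e dV hdV dW hdW (rDelta L e dV hdV hdV0 dW hdW hdW0 * (rFD L e dV hdV hdV0 dW hdW hdW0 B)⁻¹ *
        (rDelta L e dV hdV hdV0 dW hdW hdW0)⁻¹)⁻¹ Ψ 0 = (Ψ : (Fin (n + n) → AdeleRing (𝓞 (Fp L)) (Fp L)) → ℂ) 0 := by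
  have h := rFD_mem_evalZeroFixing_of_mem_closure L e dV hdV hdV0 dW hdW hdW0
    (deltaD_conj_mem_closure_of_mulVec_diag L e dV hdV hdV0 dW hdW hdW0 B hB)
  rw [← map_conj_inv_eq' (rFD L e dV hdV hdV0 dW hdW hdW0) (deltaD L) B] at h
  exact h Ψ

end DeltaFixing

end Literature.NumberTheory.GelbartRogawski1991.GRConstruction

end
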